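import Mathlib
import Literature.AlgebraicGeometry.Resolution.FormalAxisOfNearChain
import HarnessLib

/-!
# The `𝔪`-adic limit of the shear-lifted third parameters

Topic: `Literature/AlgebraicGeometry/Resolution`. V. Cossart, U. Jannsen, S. Saito, LNM 2270 (2020),
Claim 13.8 (`u₂ ↦ u₂ + Σ_q φ_q u₁^{q+1}`, an element of the completion) [cite: CossartJannsenSaito2020, Claim 13.8];
V. Cossart, O. Piltant, J. Algebra 321 (2009), proof of Prop. 4.4 p. 11 ("`x` belongs to the strict transform of a
formal curve") [cite: CossartPiltant2008, Prop. 4.4]; H. Matsumura, *Commutative Ring Theory*, Thm. 8.10 (Krull)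
[cite: Matsumura1987, Thm. 8.10].

OURS (brick B5a of the `τ = 1` endgame): the level-`0` third parameters `v_N` of `ShearLiftRecursion`
(`v_{N+1} − v_N ∈ (u^{p_N})`, `v_{N+1} = v_N` at curve steps, `p_{N+1} = p_N + [pt N]`) converge `𝔪`-adically —
either the point steps are infinitely many and `p_N → ∞`, or `v_N` is eventually constant — to an element `v̂` of
`R̂` with `v̂ ≡ v_0 mod (u) R̂` (ideals of `R̂` are closed). F-71 / T1 / N2 NOT proved; no summit statement is proved.
-/

noncomputable section

open IsLocalRing

namespace Literature.AlgebraicGeometry.Resolution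

universe u

variable {R : Type u} [CommRing R] [IsRegularLocalRing R]

/-- **B5a (OURS). The `𝔪`-adic limit of the shear-lifted third parameters.** For `u ∈ 𝔪`, a sequence `v_N`
with `v_{N+1} − v_N ∈ (u^{p_N})`, `v_{N+1} = v_N` whenever `N` is not a point step, and `p_0 = 1`,
`p_{N+1} = p_N + 1` at point steps, `p_{N+1} = p_N` otherwise: there is `v̂ ∈ R̂` with `v̂ − v_0 ∈ (u) R̂` and
`v̂ − v_N ∈ 𝔪̂^k` for all large `N`, for every `k`. [cite: CossartJannsenSaito2020, Claim 13.8]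
[cite: CossartPiltant2008, Prop. 4.4 (proof, p. 11)] [cite: Matsumura1987, Thm. 8.10] -/
theorem exists_adicLimit_of_shearLift (u : R) (hu : u ∈ maximalIdeal R)
    (v : ℕ → R) (p : ℕ → ℕ) (pt : ℕ → Prop) (hp0 : p 0 = 1)
    (hpS : ∀ N, (pt N → p (N + 1) = p N + 1) ∧ (¬ pt N → p (N + 1) = p N))
    (hvdiff : ∀ N, v (N + 1) - v N ∈ Ideal.span {u ^ p N}) (hvcv : ∀ N, ¬ pt N → v (N + 1) = v N) :
    ∃ vh : AdicCompletion (maximalIdeal R) R,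
      vh - algebraMap R (AdicCompletion (maximalIdeal R) R) (v 0) ∈
        Ideal.span {algebraMap R (AdicCompletion (maximalIdeal R) R) u} ∧
      ∀ k, ∃ N₀, ∀ N, N₀ ≤ N →
        vh - algebraMap R (AdicCompletion (maximalIdeal R) R) (v N) ∈
          maximalIdeal (AdicCompletion (maximalIdeal R) R) ^ k := by
  classical
  haveI : IsRegularLocalRing (AdicCompletion (maximalIdeal R) R) := isRegularLocalRing_adicCompletion R
  -- `p` is monotone
  have hpstep : ∀ N, p N ≤ p (N + 1) := fun N => by
    by_cases h : pt N
    · rw [(hpS N).1 h]; exact Nat.le_succ _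
    · rw [(hpS N).2 h]
  have hpmono : Monotone p := monotone_nat_of_le_succ hpstep
  -- telescoping: `v_N − v_M ∈ (u^{p_M})` and `∈ (u)` for `M ≤ N`
  have htel : ∀ M N, M ≤ N → v N - v M ∈ Ideal.span {u ^ p M} := by
    intro M N hMN
    obtain ⟨d, rfl⟩ := Nat.exists_eq_add_of_le hMN
    induction d with
    | zero => simp
    | succ d ih =>
      have h1 : v (M + (d + 1)) - v (M + d) ∈ Ideal.span {u ^ p M} := by
        rw [← Nat.add_assoc]
        refine Ideal.span_singleton_le_span_singleton.mpr ?_ (hvdiff (M + d))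
        exact pow_dvd_pow u (hpmono (Nat.le_add_right M d))
      have h2 := ih (Nat.le_add_right M d)
      have : v (M + (d + 1)) - v M = (v (M + (d + 1)) - v (M + d)) + (v (M + d) - v M) := by ring
      rw [this]; exact Ideal.add_mem _ h1 h2
  have hp1 : ∀ N, 1 ≤ p N := fun N => hp0 ▸ hpmono (Nat.zero_le N)
  -- the Cauchy property: `v_N − v_{N₀} ∈ 𝔪^k` for `N ≥ N₀ = N₀(k)`
  have hcauchy : ∀ k, ∃ N₀, ∀ N, N₀ ≤ N → v N - v N₀ ∈ maximalIdeal R ^ k := by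
    intro k
    by_cases hk : ∃ N, k ≤ p N
    · obtain ⟨N₀, hN₀⟩ := hk
      refine ⟨N₀, fun N hN => ?_⟩
      have h := htel N₀ N hN
      have hle : Ideal.span {u ^ p N₀} ≤ maximalIdeal R ^ k :=
        (Ideal.span_singleton_le_iff_mem _).mpr (Ideal.pow_le_pow_right hN₀ (Ideal.pow_mem_pow hu _))
      exact hle h
    · push Not at hk
      obtain ⟨b, N₀, hb⟩ := converges_of_monotone_of_bounded hpmono (c := k) fun n => (hk n).le
      refine ⟨N₀, fun N hN => ?_⟩
      -- beyond `N₀` there are no point steps, so `v` is constant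
      have hconst : ∀ d, v (N₀ + d) = v N₀ := by
        intro d
        induction d with
        | zero => rfl
        | succ d ih =>
          have hnpt : ¬ pt (N₀ + d) := fun hq => by
            have h1 := (hpS (N₀ + d)).1 hq
            have h2 := hb (N₀ + d) (Nat.le_add_right _ _)
            have h3 := hb (N₀ + d + 1) (by omega)
            omega
          rw [← Nat.add_assoc, hvcv _ hnpt, ih]
      obtain ⟨d, rfl⟩ := Nat.exists_eq_add_of_le hN
      rw [hconst d, sub_self]; exact Ideal.zero_mem _
  choose N₀ hN₀ using hcauchy
  -- the reindexed Cauchy sequence and its limit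
  have hseq : ∀ k, v (N₀ (k + 1)) - v (N₀ k) ∈ maximalIdeal R ^ k := by
    intro k
    rcases le_total (N₀ k) (N₀ (k + 1)) with h | h
    · exact hN₀ k _ h
    · have h' := hN₀ (k + 1) _ h
      rw [← neg_sub, Ideal.neg_mem_iff]
      exact Ideal.pow_le_pow_right (Nat.le_succ k) h'
  refine ⟨adicLimit (fun k => v (N₀ k)) hseq, ?_, fun k => ⟨N₀ k, fun N hN => ?_⟩⟩
  · -- `v̂ − v_0 ∈ (u) R̂`: ideals of `R̂` are closed
    have hmem : ∀ n, Ideal.span {adicLimit (fun k => v (N₀ k)) hseq -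
        algebraMap R (AdicCompletion (maximalIdeal R) R) (v 0)} ≤
        Ideal.span {algebraMap R (AdicCompletion (maximalIdeal R) R) u} ⊔
          maximalIdeal (AdicCompletion (maximalIdeal R) R) ^ n := by
      intro n
      rw [Ideal.span_singleton_le_iff_mem]
      have h1 := adicLimit_sub_of_mem_pow (fun k => v (N₀ k)) hseq n
      have h2 : algebraMap R (AdicCompletion (maximalIdeal R) R) (v (N₀ n)) -
          algebraMap R (AdicCompletion (maximalIdeal R) R) (v 0) ∈
          Ideal.span {algebraMap R (AdicCompletion (maximalIdeal R) R) u} := by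
        rw [← map_sub]
        have h := htel 0 (N₀ n) (Nat.zero_le _)
        rw [hp0, pow_one] at h
        obtain ⟨t, ht⟩ := Ideal.mem_span_singleton'.mp h
        rw [← ht, map_mul]
        exact Ideal.mul_mem_left _ _ (Ideal.mem_span_singleton_self _)
      have : adicLimit (fun k => v (N₀ k)) hseq - algebraMap R (AdicCompletion (maximalIdeal R) R) (v 0) =
          (algebraMap R _ (v (N₀ n)) - algebraMap R _ (v 0)) +
            (adicLimit (fun k => v (N₀ k)) hseq - algebraMap R _ (v (N₀ n))) := by ring
      rw [this]
      exact Submodule.add_mem_sup h2 h1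
    have h := le_of_forall_le_sup_pow hmem
    exact (Ideal.span_singleton_le_iff_mem _).mp h
  · -- `v̂ − v_N ∈ 𝔪̂^k` for `N ≥ N₀ k`
    have h1 := adicLimit_sub_of_mem_pow (fun k => v (N₀ k)) hseq k
    have h2 : algebraMap R (AdicCompletion (maximalIdeal R) R) (v (N₀ k)) -
        algebraMap R (AdicCompletion (maximalIdeal R) R) (v N) ∈
        maximalIdeal (AdicCompletion (maximalIdeal R) R) ^ k := by
      rw [← map_sub, AdicCompletion.maximalIdeal_eq_map, ← Ideal.map_pow]
      refine Ideal.mem_map_of_mem _ ?_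
      rw [← neg_sub, Ideal.neg_mem_iff]
      exact hN₀ k N hN
    have : adicLimit (fun k => v (N₀ k)) hseq - algebraMap R (AdicCompletion (maximalIdeal R) R) (v N) =
        (adicLimit (fun k => v (N₀ k)) hseq - algebraMap R _ (v (N₀ k))) +
          (algebraMap R _ (v (N₀ k)) - algebraMap R _ (v N)) := by ring
    rw [this]
    exact Ideal.add_mem _ h1 h2

end Literature.AlgebraicGeometry.Resolution

end
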